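import Literature.MathematicalPhysics.QuantumFieldTheory.Balaban1983to89.Beta.RemainderOriginTwoLetters

/-!
# Bałaban, *The variational problem and background fields in renormalization group method for lattice gauge
# theories*, Commun. Math. Phys. **102** (1985) 277–309 — THE LEFT ENTRIES of the (190) letter of `(δ/δB)𝓗(0) = H₀ + G̃Δ⁽²⁾H₀`
# in a background: for any linear left entry `E` (print: `∇_U`, `Δ_U`, the 1-jet — the other lines of [5] (3.42) ∕ (190)), the
# majorant of `E∘(H₀ + G̃Δ⁽²⁾H₀)` FROM V79's TWO LETTERS PLUS ONE: the `E`-row of `G₀ = Δ_a⁻¹`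

CITATION HEADER (lean-in-tree rule 2026-08-18).  Source: T. Bałaban, Commun. Math. Phys. **102** (1985) 277–309,
doi:10.1007/BF01229381 [Balaban1985Variational] (cell paper B11 = [15] of [Balaban1987RG1]; held
`paper:balaban1985-cmp102-variational-background`, journal page = PDF page + 276); its ref. [5] = *Propagators for lattice gauge
theories in a background field*, Commun. Math. Phys. **99** (1985) 389–434 [Balaban1985BackgroundPropagators] (B9;
`paper:balaban1985-cmp99-background-propagators`, journal page = PDF page + 388); its ref. [3] = *Propagators and renormalization
transformations for lattice gauge theories. II*, Commun. Math. Phys. **96** (1984) 223–250 [Balaban1984PropagatorsII] (B6).  Passages used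
(loci as quoted in the headers of V79 `Beta.RemainderOriginTwoLetters` and of `B11TildeG190`, and re-read this generation in the held text
layers for [15] pp. 297, 306–308, [5] pp. 397–399, 420–423): [15] (129) p. 297 (*«… and satisfies the bound (3.133) [5] with the additional inequality for the covariant
Laplace operator»*), (131) p. 298, p. 306 after (179), (180) p. 306, (182) p. 307,
(186)–(187) p. 308, (190) p. 308; [5] Thm 3.1 (3.42) p. 397 (the lines of (3.42): the value, the covariant derivative `∇_U`, the covariant
Laplacian `Δ_U` and the Hölder quotient of the propagator applied to a localized function), Thm 3.3 p. 399 (*«the operator G(U) (a = 1)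
satisfies the inequalities (3.42)–(3.47), with G′(U) replaced by G(U)»*), (3.132)–(3.133) p. 422, (3.137)–(3.138) p. 423; [3] (2.51)–(2.56)
pp. 232–233, Lemma 2.1 (2.61) p. 234.

WHY THIS FILE (audit cell `pub-balaban`, BINDER row (D4), OWNER lineage `b2b-balaban-beta-an4`, gen 111).  NODE D of the row is the (190)
letter of the derivative `(δ/δB)𝓗(0) = H₀ + G̃Δ⁽²⁾H₀` ([15] (182) at the origin) consumed as `Data190.h190 : ∀ n i, Ineq190 (bBn n) (boutn n i)
(dHn n) …` — ONE inequality for EACH local size `i` entering the (4.4)-functional of [I] (`|𝐀|`, `|P₁𝐀|`, `|∇^ξ𝐀|`, `|Δ^ξ𝐀|`), i.e. for each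
LINE of [5] (3.42) ∕ [15] (190).  V79 `Beta.RemainderOriginTwoLetters.hasMaj_origin_of_two_letters` assembles the VALUE line from two analytic
letters (`hG0`: Thm 3.3 (3.42) first entry for `G₀ = Δ_a⁻¹`; `hInv₀`: the (3.132)-shape bound of `(QG₀Q*)⁻¹`) and structural ones.  THIS FILE does
the same for ANY LEFT ENTRY `E : FA → FE` (a linear map into a further block-normed space `bE`; print: `E = ∇_U`, `Δ_U`, the 1-jet): the ONE
extra analytic input is **`hEG0 : HasMaj b3 bE (E∘G₀) (B_E·e^{−δ₁d})`** — the `E`-line of (3.42) for `G₀` (Thm 3.3: *«with G′(U) replaced by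
G(U)»*) — and NOTHING else: `E∘H₀ = (E∘G₀)Q*·Inv₀·J` is `Beta.RemainderOriginBaseLetters.hasMaj_H0_of_base_letters` with `G₀ := E∘G₀` (p. 297:
*«(3.133) [5] with the additional inequality for the covariant Laplace operator»*); `E∘G′ = E∘G₀ + (E∘G₀)Δ⁽²⁾G′` (the resolvent identity of p. 306
composed with `E`: one local factor, one row sum against V79's own majorant of `G′`); `E∘G̃ = E∘G′ − (E∘G′Q*)·Inv′·(QG′)` is
`B11TildeG190.hasMaj_leftEntry_tildeG` (*«with E = ∇, Δ_U, the 1-jet, the other entries of (3.42)/(186)»*); and `E∘(G̃Δ⁽²⁾H₀) = (E∘G̃)∘(Δ⁽²⁾H₀)`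
with V79's own `Δ⁽²⁾H₀` letter.
* **`hasMaj_origin_leftEntry_of_two_letters`** — under V79's hypotheses (verbatim: the two letters `hG0`, `hInv₀`; `H₀ = G₀Q*Inv₀J` with `J`
  local; `Δ⁽²⁾`, `Q`, `Q*` local; the two resolvent identities with a priori bounds; the two smallnesses `q, q_I < 1`; `G̃ = G′P₀′*`; the
  rate ladder `ρ + 5σ ≤ δ₁, δ_I`) PLUS `E`, `bE`, `hEG0`: `HasMaj bB bE (E∘(H₀ + G̃Δ⁽²⁾H₀)) ((A₀ᴱ + κ₃B_G̃ᴱθ_Dc)·e^{−ρd})` with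
  `A₀ᴱ = κ_{Q′}(κ₃B_Eν_{Q*}e^{δ₁r_Q})(κ_QB_Iν_Je^{δ_Ir_J})c` (the derived `E`-line of (3.133)), `B_{G′}ᴱ = B_E + κ_N(κ₃B_Eλe^{δ₁r_D})B_{G′}c`,
  `B_G̃ᴱ = B_{G′}ᴱ + κ_Nκ₃κ_Qκ_{Q′}ν_Qν_{Q*}B_I′B_{G′}ᴱB_{G′}e^{2(ρ+2σ)r_Q}c²`, and V79's `θ_D`, `B_{G′}`, `B_I′` — all bound to their closed
  forms by `h…` hypotheses (instantiate with `rfl`).  With `E = 1` (and `bE = bN`, `B_E = B`) it is V79's theorem again.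
* **`ineq190_origin_leftEntry_of_two_letters`** — the `Ineq190 bB bE (E∘(H₀ + G̃Δ⁽²⁾H₀)) (A₀ᴱ + κ₃B_G̃ᴱθ_Dc) δ` form for `δ/8 ≤ ρ` — the
  `E`-line of (190) at the origin (entries `n = 2, 3` of `B11.pref190` when `E = ∇_U`, `Δ_U` on the tree's carriers).
CONSEQUENCE FOR THE ROW (planning-grade, kernel-backed): every further line of NODE D at the origin costs EXACTLY ONE more letter — the same line
of (3.42) for the bond Green's function `G₁,k` — so on NE9's tower the gradient ∕ divergence rows of `G₁,k` in preparation in the NE9 cell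
(ne9-leaf-03's (DGL)∕(DGK) `B9Eq326G1DivergenceRowOfLetters`, the OWNER t4-ne9-p1's (E2) `B9Eq326G1kSliceGradRowClosed`) plug in through the
same junction pattern as the value row did ((K64) → «Y4d» → «Y5b∕c»).

HONEST SCOPE.  [folklore] composition of `Beta.RemainderOriginBaseLetters` §§1–2, `Beta.RemainderInvQGQNewG` §3 and
`B11TildeG190.hasMaj_leftEntry_tildeG`; NO estimate of [5] or [15] is proved; `hG0`, `hEG0`, `hInv₀` stay hypotheses of the printed SHAPE;
nothing identifies Bałaban's step-`k` objects with tree terms (NODE O); the rate ladder and constants are this file's, absorbed in print's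
*«O(1)»*, *«δ₀»* (cell DIVERGENCE D-B11-25).  Row (D4) class UNCHANGED (instance 0∕1; D4 DISCHARGE NO DATE); NOT B12 Thm 2, NOT BetaPertH, NOT
continuum, NOT Clay.  HONEST DEPENDENCY (cell line): continuum YM on T⁴ ⇐ BetaPertH ∧ nine spine estimates (0/9 proved); BetaPertH ⇐ (D1) ∧
(D4) ∧ CAP+tail; G-an2-4 gates asym, D1 and NE2/3/4.  NEW file importing V79 only; nothing modified; 0 `def`; standard axioms; no `sorry`.
-/

namespace Literature.MathematicalPhysics.QuantumFieldTheory.Balaban1983to89.Beta.RemainderOriginLeftEntry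

open Literature.MathematicalPhysics.QuantumFieldTheory.Balaban1983to89
open Finset B6RandomWalk B11SectG B11Reparam190 B11SupSize190 B11TildeG190
open Beta.RemainderOriginBaseLetters Beta.RemainderInvQGQNewG

variable {g : B6.Geometry}

section LeftEntry

variable {FB FA F3 FQ FE : Type} [AddCommGroup FB] [Module ℝ FB] [AddCommGroup FA] [Module ℝ FA]
  [AddCommGroup F3] [Module ℝ F3] [AddCommGroup FQ] [Module ℝ FQ] [AddCommGroup FE] [Module ℝ FE]

/-! ## The left entries of NODE D at the origin: `E∘(H₀ + G̃Δ⁽²⁾H₀)` from `hG0`, `hInv₀` and the `E`-row of `G₀` -/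

/-- **THE `E`-LINE OF THE (190) LETTER OF `(δ/δB)𝓗(0) = H₀ + G̃Δ⁽²⁾H₀` FROM V79's TWO LETTERS AND THE `E`-ROW OF `G₀`.**  Setting and
hypotheses = `Beta.RemainderOriginTwoLetters.hasMaj_origin_of_two_letters` verbatim ((115): `Δ_a : FA → F3`; `G₀, G′ : F3 → FA`; `Δ⁽²⁾ : FA →
F3`; `Q : FA → FQ`, `Q* : FQ → F3`; the B-data in `FB`; sizes `bB`, `bN`, `b3`, `bQ`, `bQ′`; the letters `hG0`, `hInv0`; `H₀ = G₀Q*·Inv₀·J`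
with `J` local; `Δ⁽²⁾`, `Q`, `Q*` local; `G′ = G₀ + G₀Δ⁽²⁾G′`, `Inv′ = Inv₀ − Inv₀PInv′` with a priori bounds; `q, q_I < 1`; `G̃ = G′ −
G′Q*·Inv′·QG′`; (2.54), (2.61) at the rate `σ` with constant `c`; `ρ + 5σ ≤ δ₁`, `ρ + 5σ ≤ δ_I`), PLUS a linear LEFT ENTRY `E : FA → FE` into
a block-normed space `bE` and its ONE letter `hEG0 : HasMaj b3 bE (E∘G₀) (B_Ee^{−δ₁d})` ([5] (3.42): the line of `E` — `∇_U`, `Δ_U`, … —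
for `G₀ = Δ_a⁻¹`, Thm 3.3).  CONCLUSION: `E∘(H₀ + G̃Δ⁽²⁾H₀)` has the majorant `(A₀ᴱ + κ₃B_G̃ᴱθ_Dc)·e^{−ρd}` from `bB` into `bE`, where
`A₀ᴱ` (`hA₀E`: the `E`-line of (3.133), `hasMaj_H0_of_base_letters` at `G₀ := E∘G₀`), `B_{G′}ᴱ` (`hBEG'`: `E∘G′ = E∘G₀ + (E∘G₀)Δ⁽²⁾G′`),
`B_G̃ᴱ` (`hBEt`: `B11TildeG190.hasMaj_leftEntry_tildeG`) and V79's `A₀`, `θ_D`, `q`, `B_{G′}`, `θ_P`, `q_I`, `B_I′` are bound to their closed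
forms by hypotheses (instantiate with `rfl`).  Rate ladder as V79: `G′` at `ρ + 4σ` (read at `ρ + 2σ`), `(QG′Q*)⁻¹` at `ρ + 3σ`, `E∘G̃` at
`ρ + σ`, the products at `ρ`.
[cite: Balaban1985Variational, (129)–(131) pp.297–298, p.306 after (179), (180) p.306, (182) p.307, (186)–(187) p.308, (190) p.308; Balaban1985BackgroundPropagators, Thm 3.1 (3.42) p.397, Thm 3.3 p.399, (3.132)–(3.133) p.422, (3.137)–(3.138) p.423; Balaban1984PropagatorsII, (2.51)–(2.56) pp.232–233, Lemma 2.1 (2.61) p.234] -/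
theorem hasMaj_origin_leftEntry_of_two_letters
    {bB : BlockNorm g FB} {bN : BlockNorm g FA} {b3 : BlockNorm g F3} {bQ bQ' : BlockNorm g FQ} {bE : BlockNorm g FE}
    {H0 : FB →ₗ[ℝ] FA} {D2 : FA →ₗ[ℝ] F3} {G0 G' Gt : F3 →ₗ[ℝ] FA} {Q : FA →ₗ[ℝ] FQ} {Qs : FQ →ₗ[ℝ] F3}
    {Inv0 Inv' : FQ →ₗ[ℝ] FQ} {J : FB →ₗ[ℝ] FQ} (E : FA →ₗ[ℝ] FE) {KD KQ KQs KJ : g.Site → g.Site → ℝ}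
    {B δ₁ BI δI M₀ MI lam rD νQ νs rQ νJ rJ ρ σ c A₀ θD q BG' θP qI BI' BE A₀E BEG' BEt : ℝ}
    (htri : Triangle254 g) (hd : ∀ a b : g.Site, 0 ≤ g.dist a b) (hrow : RowSum g σ c) (hc : 0 ≤ c)
    (hσ : 0 ≤ σ) (hρ : 0 ≤ ρ) (hρ₁ : ρ + 5 * σ ≤ δ₁) (hρI : ρ + 5 * σ ≤ δI)
    (hB : 0 ≤ B) (hBI : 0 ≤ BI) (hM₀ : 0 ≤ M₀) (hMI : 0 ≤ MI) (hlam : 0 ≤ lam)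
    (hνQ : 0 ≤ νQ) (hνs : 0 ≤ νs) (hνJ : 0 ≤ νJ) (hBE : 0 ≤ BE)
    -- the two analytic letters of V79 and THE ONE NEW LETTER: the left entry `E` of `G₀` ((3.42), the entry of `E`)
    (hG0 : HasMaj b3 bN G0 (fun a b => B * Real.exp (-(δ₁ * g.dist a b))))
    (hEG0 : HasMaj b3 bE (E ∘ₗ G0) (fun a b => BE * Real.exp (-(δ₁ * g.dist a b))))
    (hInv0 : HasMaj bQ bQ' Inv0 (fun a b => BI * Real.exp (-(δI * g.dist a b))))
    -- H₀ = G₀Q*(QG₀Q*)⁻¹J with the source scaling J local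
    (hH0def : H0 = ((G0 ∘ₗ Qs) ∘ₗ Inv0) ∘ₗ J)
    (hKJ : ∀ a b, 0 ≤ KJ a b) (hJloc : ∀ a b, KJ a b ≠ 0 → g.dist a b ≤ rJ)
    (hJcol : ∀ b, ∑ a : g.Site, KJ a b ≤ νJ) (hJ : HasMaj bB bQ J KJ)
    -- Δ⁽²⁾ local
    (hKD : ∀ a b, 0 ≤ KD a b) (hDloc : ∀ a b, KD a b ≠ 0 → g.dist a b ≤ rD)
    (hDrow : ∀ a, ∑ b : g.Site, KD a b ≤ lam) (hDcol : ∀ b, ∑ a : g.Site, KD a b ≤ lam)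
    (hD2 : HasMaj bN b3 D2 KD)
    -- the new G′: resolvent identity, a priori bound, smallness
    (hfix : G' = G0 + (G0 ∘ₗ D2) ∘ₗ G') (hap : HasMaj b3 bN G' (fun _ _ => M₀))
    (hq_def : q = bN.κ * (b3.κ * B * lam * Real.exp (δ₁ * rD)) * c) (hq : q < 1) (hBG' : BG' = B * (1 - q)⁻¹)
    -- Q, Q* local
    (hKQ : ∀ a b, 0 ≤ KQ a b) (hQloc : ∀ a b, KQ a b ≠ 0 → g.dist a b ≤ rQ)
    (hQrow : ∀ a, ∑ b : g.Site, KQ a b ≤ νQ) (hQ : HasMaj bN bQ Q KQ)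
    (hKQs : ∀ a b, 0 ≤ KQs a b) (hQsloc : ∀ a b, KQs a b ≠ 0 → g.dist a b ≤ rQ)
    (hQscol : ∀ b, ∑ a : g.Site, KQs a b ≤ νs) (hQs : HasMaj bQ' b3 Qs KQs)
    -- (QG′Q*)⁻¹: second resolvent identity, a priori bound, smallness
    (hfixI : Inv' = Inv0 - (Inv0 ∘ₗ (Q ∘ₗ (((G0 ∘ₗ D2) ∘ₗ G') ∘ₗ Qs))) ∘ₗ Inv')
    (hapI : HasMaj bQ bQ' Inv' (fun _ _ => MI))
    (hθP : θP = bN.κ * (b3.κ * (bN.κ * (b3.κ * B * lam * Real.exp (δ₁ * rD)) * BG' * c) * νs *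
      Real.exp ((ρ + 4 * σ) * rQ)) * νQ * Real.exp ((ρ + 4 * σ) * rQ))
    (hqI : qI = bQ'.κ * (bQ.κ * BI * θP * c) * c) (hqI1 : qI < 1) (hBI' : BI' = BI * (1 - qI)⁻¹)
    -- G̃ = G′P₀′*
    (hGt : Gt = G' - (G' ∘ₗ Qs) ∘ₗ Inv' ∘ₗ (Q ∘ₗ G'))
    -- the derived constants
    (hA₀ : A₀ = bQ'.κ * (b3.κ * B * νs * Real.exp (δ₁ * rQ)) * (bQ.κ * BI * νJ * Real.exp (δI * rJ)) * c)
    (hθD : θD = bN.κ * A₀ * lam * Real.exp (ρ * rD))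
    (hA₀E : A₀E = bQ'.κ * (b3.κ * BE * νs * Real.exp (δ₁ * rQ)) * (bQ.κ * BI * νJ * Real.exp (δI * rJ)) * c)
    (hBEG' : BEG' = BE + bN.κ * (b3.κ * BE * lam * Real.exp (δ₁ * rD)) * BG' * c)
    (hBEt : BEt = BEG' + bN.κ * b3.κ * bQ.κ * bQ'.κ * νQ * νs * BI' * BEG' * BG' *
      Real.exp ((ρ + 2 * σ) * rQ) * Real.exp ((ρ + 2 * σ) * rQ) * c * c) :
    HasMaj bB bE (E ∘ₗ (H0 + Gt ∘ₗ (D2 ∘ₗ H0)))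
      (fun a b => (A₀E + b3.κ * BEt * θD * c) * Real.exp (-(ρ * g.dist a b))) := by
  have hδ₁ : 0 ≤ δ₁ := by linarith
  -- H₀ (plain) and E∘H₀ at the rate ρ (Beta.RemainderOriginBaseLetters §1b, the second with G₀ := E∘G₀)
  have hH0 : HasMaj bB bN H0 (fun a b => A₀ * Real.exp (-(ρ * g.dist a b))) := by
    rw [hA₀]
    exact hasMaj_H0_of_base_letters htri hd hrow hB hBI hνs hνJ hρ hσ (by linarith) (by linarith) hH0def hG0 hKQs
      hQsloc hQscol hQs hInv0 hKJ hJloc hJcol hJ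
  have hEH0def : E ∘ₗ H0 = (((E ∘ₗ G0) ∘ₗ Qs) ∘ₗ Inv0) ∘ₗ J := by rw [hH0def]; rfl
  have hEH0 : HasMaj bB bE (E ∘ₗ H0) (fun a b => A₀E * Real.exp (-(ρ * g.dist a b))) := by
    rw [hA₀E]
    exact hasMaj_H0_of_base_letters htri hd hrow hBE hBI hνs hνJ hρ hσ (by linarith) (by linarith) hEH0def hEG0 hKQs
      hQsloc hQscol hQs hInv0 hKJ hJloc hJcol hJ
  have hA₀0 : 0 ≤ A₀ := by
    rw [hA₀]
    have := bQ'.κ_nonneg; have := b3.κ_nonneg; have := bQ.κ_nonneg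
    positivity
  -- the new G′ at the rate ρ + 4σ, then read at ρ + 2σ
  have hq0 : 0 ≤ q := by
    rw [hq_def]
    exact mul_nonneg (mul_nonneg bN.κ_nonneg
      (mul_nonneg (mul_nonneg (mul_nonneg b3.κ_nonneg hB) hlam) (Real.exp_nonneg _))) hc
  have hBG'0 : 0 ≤ BG' := by rw [hBG']; exact mul_nonneg hB (inv_nonneg.mpr (by linarith))
  have hG' : HasMaj b3 bN G' (fun a b => BG' * Real.exp (-((ρ + 4 * σ) * g.dist a b))) := by
    rw [hBG', hq_def]
    exact hasMaj_newG_of_fix_local htri hd hrow hB hM₀ hlam (by linarith) hσ (by linarith) hKD hDloc hDcol hG0 hD2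
      hfix hap (by rw [← hq_def]; exact hq)
  have h2 : HasMaj b3 bN G' (fun a b => BG' * Real.exp (-((ρ + 2 * σ) * g.dist a b))) :=
    hG'.of_rate_le hd hBG'0 (by linarith)
  -- (QG′Q*)⁻¹ at the rate ρ + 3σ
  have hInv : HasMaj bQ bQ' Inv' (fun a b => BI' * Real.exp (-((ρ + 3 * σ) * g.dist a b))) := by
    rw [hBI']
    exact hasMaj_invQGQ_newG htri hd hrow hc hB hBG'0 hBI hMI hlam hνQ hνs hσ (by linarith) (by linarith) le_rfl
      (by linarith) (by linarith) hKD hDloc hDcol hD2 hG0 hG' hKQ hQloc hQrow hQ hKQs hQsloc hQscol hQs hInv0 hfixI hapI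
      hθP hqI hqI1
  have hθP0 : 0 ≤ θP := by
    rw [hθP]
    have := bN.κ_nonneg; have := b3.κ_nonneg
    positivity
  have hqI0 : 0 ≤ qI := by
    rw [hqI]
    have := bQ'.κ_nonneg; have := bQ.κ_nonneg
    positivity
  have hBI'0 : 0 ≤ BI' := by rw [hBI']; exact mul_nonneg hBI (inv_nonneg.mpr (by linarith))
  -- the left entry of the new G′ at the rate ρ + 2σ: E∘G′ = E∘G₀ + ((E∘G₀)Δ⁽²⁾)G′
  have hK : HasMaj bN bE ((E ∘ₗ G0) ∘ₗ D2)
      (fun a b => b3.κ * BE * lam * Real.exp (δ₁ * rD) * Real.exp (-(δ₁ * g.dist a b))) :=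
    hasMaj_comp_localRight htri hBE hδ₁ hKD hDloc hDcol hEG0 hD2
  have hθ0 : 0 ≤ b3.κ * BE * lam * Real.exp (δ₁ * rD) :=
    mul_nonneg (mul_nonneg (mul_nonneg b3.κ_nonneg hBE) hlam) (Real.exp_nonneg _)
  have hKG : HasMaj b3 bE (((E ∘ₗ G0) ∘ₗ D2) ∘ₗ G')
      (fun a b => bN.κ * (b3.κ * BE * lam * Real.exp (δ₁ * rD)) * BG' * c * Real.exp (-((ρ + 2 * σ) * g.dist a b))) :=
    hasMaj_comp_exp htri hd hrow hθ0 hBG'0 (by linarith) (by linarith) (by linarith) hK hG'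
  have h2E : HasMaj b3 bE (E ∘ₗ G') (fun a b => BEG' * Real.exp (-((ρ + 2 * σ) * g.dist a b))) := by
    have hsum := (hEG0.of_rate_le hd hBE (show ρ + 2 * σ ≤ δ₁ by linarith)).add hKG
    refine (hsum.congr fun μ => ?_).mono fun a b => le_of_eq (by rw [hBEG']; ring)
    have e := LinearMap.congr_fun hfix μ
    simp only [LinearMap.add_apply, LinearMap.comp_apply] at e ⊢
    conv_rhs => rw [e]
    rw [map_add]
  have hBEG'0 : 0 ≤ BEG' := by
    rw [hBEG']
    have := bN.κ_nonneg; have := b3.κ_nonneg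
    positivity
  -- the left entry of G̃ at the rate ρ + σ (B11TildeG190.hasMaj_leftEntry_tildeG)
  have h3E : HasMaj b3 bE (E ∘ₗ Gt) (fun a b => BEt * Real.exp (-((ρ + σ) * g.dist a b))) := by
    rw [hBEt]
    exact hasMaj_leftEntry_tildeG E htri hd hrow hc hBG'0 hBEG'0 hBI'0 hνQ hνs (by linarith) hσ (by linarith)
      (by linarith) hGt h2 h2E hKQ hQloc hQrow hQ hKQs hQsloc hQscol hQs hInv
  have hBEt0 : 0 ≤ BEt := by
    rw [hBEt]
    have := bN.κ_nonneg; have := b3.κ_nonneg; have := bQ.κ_nonneg; have := bQ'.κ_nonneg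
    positivity
  -- Δ⁽²⁾H₀ at the rate ρ, then E∘G̃∘Δ⁽²⁾H₀ at the rate ρ
  have h1 : HasMaj bB b3 (D2 ∘ₗ H0) (fun a b => θD * Real.exp (-(ρ * g.dist a b))) := by
    rw [hθD]; exact hasMaj_D2H0_of_local htri hA₀0 hρ hKD hDloc hDrow hD2 hH0
  have hθD0 : 0 ≤ θD := by
    rw [hθD]; exact mul_nonneg (mul_nonneg (mul_nonneg bN.κ_nonneg hA₀0) hlam) (Real.exp_nonneg _)
  have h4E : HasMaj bB bE ((E ∘ₗ Gt) ∘ₗ (D2 ∘ₗ H0))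
      (fun a b => b3.κ * BEt * θD * c * Real.exp (-(ρ * g.dist a b))) :=
    hasMaj_comp_exp htri hd hrow hBEt0 hθD0 hρ le_rfl le_rfl h3E h1
  -- the sum
  refine ((hEH0.add h4E).congr fun μ => ?_).mono fun a b => le_of_eq (by ring)
  simp only [LinearMap.add_apply, LinearMap.comp_apply, map_add]

/-- **THE `E`-LINE OF (190) AT THE ORIGIN**: under the hypotheses of `hasMaj_origin_leftEntry_of_two_letters`,
`Ineq190 bB bE (E∘(H₀ + G̃Δ⁽²⁾H₀)) (A₀ᴱ + κ₃B_G̃ᴱθ_Dc) δ` for every `δ` with `δ/8 ≤ ρ` — the entry of the left factor `E` (print: `n = 2`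
covariant derivative, `n = 3` covariant Laplacian of `B11.pref190`) in the currency of the row's `Data190.h190`, from EXACTLY [5] Thm 3.3's
value AND `E`-lines for `Δ_a⁻¹` in the background and the (3.132)-shape bound of `(QG₀Q*)⁻¹`.
[cite: Balaban1985Variational, (182) p.307, (190) p.308, (129) p.297; Balaban1985BackgroundPropagators, Thm 3.1 (3.42) p.397, Thm 3.3 p.399, (3.132)–(3.133) p.422, (3.137) p.423; Balaban1984PropagatorsII, Lemma 2.1 (2.61) p.234] -/
theorem ineq190_origin_leftEntry_of_two_letters
    {bB : BlockNorm g FB} {bN : BlockNorm g FA} {b3 : BlockNorm g F3} {bQ bQ' : BlockNorm g FQ} {bE : BlockNorm g FE}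
    {H0 : FB →ₗ[ℝ] FA} {D2 : FA →ₗ[ℝ] F3} {G0 G' Gt : F3 →ₗ[ℝ] FA} {Q : FA →ₗ[ℝ] FQ} {Qs : FQ →ₗ[ℝ] F3}
    {Inv0 Inv' : FQ →ₗ[ℝ] FQ} {J : FB →ₗ[ℝ] FQ} (E : FA →ₗ[ℝ] FE) {KD KQ KQs KJ : g.Site → g.Site → ℝ}
    {B δ₁ BI δI M₀ MI lam rD νQ νs rQ νJ rJ ρ σ c A₀ θD q BG' θP qI BI' BE A₀E BEG' BEt δ : ℝ}
    (htri : Triangle254 g) (hd : ∀ a b : g.Site, 0 ≤ g.dist a b) (hrow : RowSum g σ c) (hc : 0 ≤ c)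
    (hσ : 0 ≤ σ) (hρ : 0 ≤ ρ) (hρ₁ : ρ + 5 * σ ≤ δ₁) (hρI : ρ + 5 * σ ≤ δI) (hδ : δ / 8 ≤ ρ)
    (hB : 0 ≤ B) (hBI : 0 ≤ BI) (hM₀ : 0 ≤ M₀) (hMI : 0 ≤ MI) (hlam : 0 ≤ lam)
    (hνQ : 0 ≤ νQ) (hνs : 0 ≤ νs) (hνJ : 0 ≤ νJ) (hBE : 0 ≤ BE)
    (hG0 : HasMaj b3 bN G0 (fun a b => B * Real.exp (-(δ₁ * g.dist a b))))
    (hEG0 : HasMaj b3 bE (E ∘ₗ G0) (fun a b => BE * Real.exp (-(δ₁ * g.dist a b))))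
    (hInv0 : HasMaj bQ bQ' Inv0 (fun a b => BI * Real.exp (-(δI * g.dist a b))))
    (hH0def : H0 = ((G0 ∘ₗ Qs) ∘ₗ Inv0) ∘ₗ J)
    (hKJ : ∀ a b, 0 ≤ KJ a b) (hJloc : ∀ a b, KJ a b ≠ 0 → g.dist a b ≤ rJ)
    (hJcol : ∀ b, ∑ a : g.Site, KJ a b ≤ νJ) (hJ : HasMaj bB bQ J KJ)
    (hKD : ∀ a b, 0 ≤ KD a b) (hDloc : ∀ a b, KD a b ≠ 0 → g.dist a b ≤ rD)
    (hDrow : ∀ a, ∑ b : g.Site, KD a b ≤ lam) (hDcol : ∀ b, ∑ a : g.Site, KD a b ≤ lam)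
    (hD2 : HasMaj bN b3 D2 KD)
    (hfix : G' = G0 + (G0 ∘ₗ D2) ∘ₗ G') (hap : HasMaj b3 bN G' (fun _ _ => M₀))
    (hq_def : q = bN.κ * (b3.κ * B * lam * Real.exp (δ₁ * rD)) * c) (hq : q < 1) (hBG' : BG' = B * (1 - q)⁻¹)
    (hKQ : ∀ a b, 0 ≤ KQ a b) (hQloc : ∀ a b, KQ a b ≠ 0 → g.dist a b ≤ rQ)
    (hQrow : ∀ a, ∑ b : g.Site, KQ a b ≤ νQ) (hQ : HasMaj bN bQ Q KQ)
    (hKQs : ∀ a b, 0 ≤ KQs a b) (hQsloc : ∀ a b, KQs a b ≠ 0 → g.dist a b ≤ rQ)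
    (hQscol : ∀ b, ∑ a : g.Site, KQs a b ≤ νs) (hQs : HasMaj bQ' b3 Qs KQs)
    (hfixI : Inv' = Inv0 - (Inv0 ∘ₗ (Q ∘ₗ (((G0 ∘ₗ D2) ∘ₗ G') ∘ₗ Qs))) ∘ₗ Inv')
    (hapI : HasMaj bQ bQ' Inv' (fun _ _ => MI))
    (hθP : θP = bN.κ * (b3.κ * (bN.κ * (b3.κ * B * lam * Real.exp (δ₁ * rD)) * BG' * c) * νs *
      Real.exp ((ρ + 4 * σ) * rQ)) * νQ * Real.exp ((ρ + 4 * σ) * rQ))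
    (hqI : qI = bQ'.κ * (bQ.κ * BI * θP * c) * c) (hqI1 : qI < 1) (hBI' : BI' = BI * (1 - qI)⁻¹)
    (hGt : Gt = G' - (G' ∘ₗ Qs) ∘ₗ Inv' ∘ₗ (Q ∘ₗ G'))
    (hA₀ : A₀ = bQ'.κ * (b3.κ * B * νs * Real.exp (δ₁ * rQ)) * (bQ.κ * BI * νJ * Real.exp (δI * rJ)) * c)
    (hθD : θD = bN.κ * A₀ * lam * Real.exp (ρ * rD))
    (hA₀E : A₀E = bQ'.κ * (b3.κ * BE * νs * Real.exp (δ₁ * rQ)) * (bQ.κ * BI * νJ * Real.exp (δI * rJ)) * c)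
    (hBEG' : BEG' = BE + bN.κ * (b3.κ * BE * lam * Real.exp (δ₁ * rD)) * BG' * c)
    (hBEt : BEt = BEG' + bN.κ * b3.κ * bQ.κ * bQ'.κ * νQ * νs * BI' * BEG' * BG' *
      Real.exp ((ρ + 2 * σ) * rQ) * Real.exp ((ρ + 2 * σ) * rQ) * c * c) :
    Ineq190 bB bE (E ∘ₗ (H0 + Gt ∘ₗ (D2 ∘ₗ H0))) (A₀E + b3.κ * BEt * θD * c) δ := by
  have h := hasMaj_origin_leftEntry_of_two_letters E htri hd hrow hc hσ hρ hρ₁ hρI hB hBI hM₀ hMI hlam hνQ hνs hνJ hBE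
    hG0 hEG0 hInv0 hH0def hKJ hJloc hJcol hJ hKD hDloc hDrow hDcol hD2 hfix hap hq_def hq hBG' hKQ hQloc hQrow hQ hKQs
    hQsloc hQscol hQs hfixI hapI hθP hqI hqI1 hBI' hGt hA₀ hθD hA₀E hBEG' hBEt
  intro y' μ hμ y
  have hC : 0 ≤ A₀E + b3.κ * BEt * θD * c := by
    have hA₀0 : 0 ≤ A₀ := by
      rw [hA₀]
      have := bQ'.κ_nonneg; have := b3.κ_nonneg; have := bQ.κ_nonneg
      positivity
    have hA₀E0 : 0 ≤ A₀E := by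
      rw [hA₀E]
      have := bQ'.κ_nonneg; have := b3.κ_nonneg; have := bQ.κ_nonneg
      positivity
    have hq0 : 0 ≤ q := by
      rw [hq_def]
      exact mul_nonneg (mul_nonneg bN.κ_nonneg
        (mul_nonneg (mul_nonneg (mul_nonneg b3.κ_nonneg hB) hlam) (Real.exp_nonneg _))) hc
    have hBG'0 : 0 ≤ BG' := by rw [hBG']; exact mul_nonneg hB (inv_nonneg.mpr (by linarith))
    have hθP0 : 0 ≤ θP := by
      rw [hθP]
      have := bN.κ_nonneg; have := b3.κ_nonneg
      positivity
    have hqI0 : 0 ≤ qI := by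
      rw [hqI]
      have := bQ'.κ_nonneg; have := bQ.κ_nonneg
      positivity
    have hBI'0 : 0 ≤ BI' := by rw [hBI']; exact mul_nonneg hBI (inv_nonneg.mpr (by linarith))
    have hθD0 : 0 ≤ θD := by
      rw [hθD]; exact mul_nonneg (mul_nonneg (mul_nonneg bN.κ_nonneg hA₀0) hlam) (Real.exp_nonneg _)
    have hBEG'0 : 0 ≤ BEG' := by
      rw [hBEG']
      have := bN.κ_nonneg; have := b3.κ_nonneg
      positivity
    have hBEt0 : 0 ≤ BEt := by
      rw [hBEt]
      have := bN.κ_nonneg; have := b3.κ_nonneg; have := bQ.κ_nonneg; have := bQ'.κ_nonneg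
      positivity
    have := b3.κ_nonneg
    positivity
  refine (h y' μ hμ y).trans (mul_le_mul_of_nonneg_right ?_ (bB.loc_nonneg _ _))
  exact mul_le_mul_of_nonneg_left (Real.exp_le_exp.mpr (by nlinarith [hd y y'])) hC

end LeftEntry

end Literature.MathematicalPhysics.QuantumFieldTheory.Balaban1983to89.Beta.RemainderOriginLeftEntry
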